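import Mathlib
import Summits.Ventures.PercRepro2.TablePackage3

/-! # Packages certified by their tables, IV: a linear `Nodup` certificate
(seat mine-b, cell pub-perc-repro2; MINE-B.md §26.11)

The `Nodup` of a table column of ≈ 900 configurations, decided pairwise, recurses too deeply for some
farm nodes.  `noDupBits` walks the column once with a bitset of the configuration codes (`SP.encode`,
`< 2^n`): a linear kernel computation on GMP-accelerated naturals; `nodup_of_noDupBits` turns it into
`List.Nodup`. -/

namespace Summit.Ventures.PercRepro2.UHClosure

/-- a linear duplicate check on a list of naturals through a bitset accumulator -/
def noDupBits : List ℕ → ℕ → Bool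
  | [], _ => true
  | e :: l, acc => !acc.testBit e && noDupBits l (acc ||| 2 ^ e)

/-- `noDupBits` certifies `Nodup`, and every listed bit is clear in the initial accumulator -/
theorem noDupBits_spec : ∀ (l : List ℕ) (acc : ℕ), noDupBits l acc = true →
    l.Nodup ∧ ∀ x ∈ l, acc.testBit x = false
  | [], _, _ => ⟨List.nodup_nil, fun _ hx => (List.not_mem_nil hx).elim⟩
  | e :: l, acc, h => by
    simp only [noDupBits, Bool.and_eq_true, Bool.not_eq_true'] at h
    obtain ⟨hnd, hall⟩ := noDupBits_spec l (acc ||| 2 ^ e) h.2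
    refine ⟨List.nodup_cons.2 ⟨fun hmem => ?_, hnd⟩, fun x hx => ?_⟩
    · have := hall e hmem
      rw [Nat.testBit_or, Nat.testBit_two_pow_self, Bool.or_true] at this
      exact absurd this (by decide)
    · rcases List.mem_cons.1 hx with rfl | hx
      · exact h.1
      · have := hall x hx
        rw [Nat.testBit_or] at this
        exact (Bool.or_eq_false_iff.1 this).1

/-- **a list whose codes pass the bitset check is `Nodup`** -/
theorem nodup_of_noDupBits {α : Type*} (l : List α) (enc : α → ℕ)
    (h : noDupBits (l.map enc) 0 = true) : l.Nodup :=
  List.Nodup.of_map enc (noDupBits_spec (l.map enc) 0 h).1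

end Summit.Ventures.PercRepro2.UHClosure
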